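import Literature.Topology.FourManifolds.TautFoliationsGoodSubbox
import Literature.Topology.FourManifolds.TautFoliationsSquareGrid
import Literature.Topology.FourManifolds.TautFoliationsConeSquare
import Mathlib.Topology.MetricSpace.Thickening
import HarnessLib

/-!
# `C⁰` general position of a square with respect to a codimension-one foliation: cone position

For a `C⁰` codimension-one foliation `F : Literature.Topology.FourManifolds.Foliation B M` (transversely oriented, leaf
model a proper real normed space `B`, `M` Hausdorff) and a continuous map `f` of a square
`S = closedBall c₀ L ⊆ ℝ × ℝ` into `M`, we put `f` in **cone position**: `S` is cut into a grid
of small squares `Q` (`TautFoliationsSquareGrid.lean`), each assigned a flow box `e_Q` and a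
**good sub-box** `G_Q` of `e_Q` (`TautFoliationsGoodSubbox.lean`) containing `f` of the star of
`Q` and contained in the sources of the boxes of all adjacent squares — so that all comparisons
of heights between neighbouring squares are exact (`IsTransverselyOriented.exists_transitionOn`).
This file proves the existence of such a **box assignment** with a radius uniform over the grid
(`exists_boxes`): a finite cover of `f(S)` by unit sub-boxes with compact closures, a Lebesgue
number for the pulled-back cover of `S`, a thickening radius for each pair of boxes
(`IsCompact.exists_thickening_subset_open` in the box `B × ℝ`), and a modulus of uniform
continuity of the box coordinates of `f`; the mesh is then chosen below all of them.

This is the first step of the `C⁰` substitute for the general position of a disc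
(Camacho–Lins Neto, *Geometric Theory of Foliations*, Ch. VI §3, Prop. 1 and Ch. VII §2, where
the pieces of the disc are mapped into single foliation boxes before the map is modified):
the 1-skeleton of the grid is then made tame (`TautFoliationsTameFunctions.lean`) and each
square is filled by a cone in its box (`TautFoliationsConeSquare.lean`).

* `Foliation.grid c₀ L n` (**definition**): the `n × n` grid of the square `closedBall c₀ L`.
* `Foliation.exists_boxes` (**proved**): boxes `e_Q ∈ F.atlas` and a radius `ρ > 0` with
  `subbox e_Q (e_Q (f c_Q)) ρ ⊆ e_{Q'}.source` and `f (Q') ⊆ subbox e_Q (e_Q (f c_Q)) (ρ / 4)`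
  for all adjacent `Q, Q'`.

## References

* C. Camacho, A. Lins Neto, *Geometric Theory of Foliations*, Birkhäuser (1985), Ch. VI §3
  Prop. 1, Ch. VII §2 [CamachoLinsNeto1985].
* V. V. Solodov, *Components of topological foliations*, Mat. Sb. 119 (1982) (the `C⁰` Novikov
  theorem).
-/

open Set Filter Metric Topology

namespace Literature.Topology.FourManifolds

namespace Foliation

open SquareGrid

/-- A positive lower bound for finitely many positive reals. [folklore] -/
theorem exists_pos_forall_le {ι : Type*} [Finite ι] (v : ι → ℝ) (hv : ∀ i, 0 < v i) :
    ∃ ρ > (0 : ℝ), ∀ i, ρ ≤ v i := by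
  cases isEmpty_or_nonempty ι with
  | inl h => exact ⟨1, one_pos, fun i ↦ (h.false i).elim⟩
  | inr h =>
    have := Fintype.ofFinite ι
    refine ⟨Finset.univ.inf' Finset.univ_nonempty v, ?_, fun i ↦ Finset.inf'_le v (Finset.mem_univ i)⟩
    obtain ⟨i, -, hi⟩ := Finset.exists_mem_eq_inf' Finset.univ_nonempty v
    rw [hi]
    exact hv i

/-! ## The grid of a square -/

/-- The `n × n` grid of the square `closedBall c₀ L` (`L > 0`, `n > 0`). [folklore] -/
noncomputable def grid (c₀ : ℝ × ℝ) {L : ℝ} (hL : 0 < L) {n : ℕ} (hn : 0 < n) : Grid :=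
  ⟨(c₀.1 - L, c₀.2 - L), L / n, n, div_pos hL (Nat.cast_pos.2 hn), hn⟩

variable {c₀ : ℝ × ℝ} {L : ℝ} {n : ℕ}

/-- The half-side of the small squares of the grid is `L / n`. [folklore] -/
@[simp] theorem grid_ℓ (hL : 0 < L) (hn : 0 < n) : (grid c₀ hL hn).ℓ = L / n := rfl

/-- The number of squares per side of the grid is `n`. [folklore] -/
@[simp] theorem grid_n (hL : 0 < L) (hn : 0 < n) : (grid c₀ hL hn).n = n := rfl

/-- The corner of the grid. [folklore] -/
@[simp] theorem grid_a (hL : 0 < L) (hn : 0 < n) : (grid c₀ hL hn).a = (c₀.1 - L, c₀.2 - L) := rfl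

/-- **The big square of the grid is the given square.** [folklore] -/
theorem grid_S (hL : 0 < L) (hn : 0 < n) : (grid c₀ hL hn).S = closedBall c₀ L := by
  have hn' : (n : ℝ) ≠ 0 := Nat.cast_ne_zero.2 hn.ne'
  have h1 : ((grid c₀ hL hn).n : ℝ) * (grid c₀ hL hn).ℓ = L := by
    rw [grid_ℓ, grid_n]; field_simp
  have h2 : (grid c₀ hL hn).bigCentre = c₀ := by
    simp only [Grid.bigCentre, grid_a, h1]
    ext <;> simp
  rw [Grid.S, h2, h1]

variable {B : Type*} [NormedAddCommGroup B] [ProperSpace B]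
variable {M : Type*} [TopologicalSpace M] [T2Space M] (F : Foliation B M)

/-! ## Box assignment with a uniform radius -/

/-- **Box assignment for the cone position.** For a continuous map `f` of the square
`closedBall c₀ L` into `M`, there are a mesh `n`, flow boxes `e_Q ∈ F.atlas` indexed by the
squares `Q` of the `n × n` grid, and a radius `ρ > 0` such that, for all adjacent squares
`Q, Q'` (equal or among the eight neighbours): the sub-box of `e_Q` of radius `ρ` centred at
`e_Q (f c_Q)` lies in `e_{Q'}.source`, and `f (Q')` lies in the sub-box of radius `ρ / 4`.
(Camacho–Lins Neto, Ch. VI §3, proof of Prop. 1: the pieces of the disc are mapped into single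
foliation boxes; here with a Lebesgue number, pairwise thickening radii and uniform
continuity.) [cite: CamachoLinsNeto1985, Ch. VI §3 Prop. 1] -/
theorem exists_boxes (hL : 0 < L) {f : ℝ × ℝ → M} (hf : ContinuousOn f (closedBall c₀ L)) :
    ∃ (n : ℕ) (hn : 0 < n) (box : Fin n × Fin n → OpenPartialHomeomorph M (B × ℝ)) (ρ : ℝ),
      0 < ρ ∧ (∀ q, box q ∈ F.atlas) ∧
      (∀ q q', (grid c₀ hL hn).Adj q q' →
        subbox (box q) (box q (f ((grid c₀ hL hn).centre q))) ρ ⊆ (box q').source) ∧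
      (∀ q q', (grid c₀ hL hn).Adj q q' → ∀ x ∈ (grid c₀ hL hn).sq q',
        f x ∈ subbox (box q) (box q (f ((grid c₀ hL hn).centre q))) (ρ / 4)) := by
  set S : Set (ℝ × ℝ) := closedBall c₀ L with hSdef
  have hS : IsCompact S := isCompact_closedBall _ _
  -- 1. a box at each point, unit sub-boxes `W y` with compact closures `C y`, finite subcover
  choose eOf heOf hmem using F.exists_mem_source
  set W : M → Set M := fun y ↦ subbox (eOf y) (eOf y y) 1 with hWdef
  set C : M → Set M := fun y ↦ (eOf y).symm '' closedBall (eOf y y) 1 with hCdef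
  have hCcpt : ∀ y, IsCompact (C y) := fun y ↦
    (isCompact_closedBall _ _).image (F.continuous_symm_of_mem (heOf y))
  have hCsrc : ∀ y, C y ⊆ (eOf y).source := fun y ↦ by
    rintro _ ⟨p, -, rfl⟩
    exact (eOf y).map_target (by rw [F.target_eq _ (heOf y)]; exact mem_univ _)
  have hWC : ∀ y, W y ⊆ C y := fun y ↦ image_mono ball_subset_closedBall
  have hK : IsCompact (f '' S) := hS.image_of_continuousOn hf
  obtain ⟨t, -, htcov⟩ := hK.elim_nhds_subcover W fun y _ ↦
    (F.isOpen_subbox (heOf y)).mem_nhds (F.mem_subbox_self (heOf y) (hmem y) one_pos)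
  -- 2. open sets of the plane cutting `S` along `f ⁻¹ (W y)`; a Lebesgue number
  have hU : ∀ y, ∃ U : Set (ℝ × ℝ), IsOpen U ∧ f ⁻¹' W y ∩ S = U ∩ S := fun y ↦
    (continuousOn_iff'.1 hf) _ (F.isOpen_subbox (heOf y))
  choose U hUo hUeq using hU
  obtain ⟨δ₁, hδ₁, hLeb⟩ := lebesgue_number_lemma_of_metric (ι := ↥t) hS (c := fun y ↦ U y)
    (fun y ↦ hUo y) (by
      intro x hx
      obtain ⟨y, hy, hxy⟩ := mem_iUnion₂.1 (htcov (mem_image_of_mem f hx))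
      have hxU : x ∈ U y ∩ S := by rw [← hUeq]; exact ⟨hxy, hx⟩
      exact mem_iUnion.2 ⟨⟨y, hy⟩, hxU.1⟩)
  -- 3. pairwise thickening radii in the box, and their minimum `ρ`
  have hρ' : ∀ y y' : ↥t, ∃ ρ > (0 : ℝ), ∀ p ∈ (eOf y) '' (C y ∩ C y'),
      ball p ρ ⊆ (eOf y).symm ⁻¹' (eOf y').source := by
    intro y y'
    have hcpt : IsCompact ((eOf y) '' (C y ∩ C y')) :=
      ((hCcpt y).inter_right (hCcpt y').isClosed).image_of_continuousOn
        ((eOf (y : M)).continuousOn.mono (inter_subset_left.trans (hCsrc y)))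
    have hopen : IsOpen ((eOf y).symm ⁻¹' (eOf y').source) :=
      (F.continuous_symm_of_mem (heOf y)).isOpen_preimage _ (eOf (y' : M)).open_source
    have hsub : (eOf y) '' (C y ∩ C y') ⊆ (eOf y).symm ⁻¹' (eOf y').source := by
      rintro _ ⟨z, ⟨hz, hz'⟩, rfl⟩
      show (eOf y).symm (eOf y z) ∈ (eOf y').source
      rw [(eOf (y : M)).left_inv (hCsrc y hz)]
      exact hCsrc y' hz'
    obtain ⟨ρ, hρ, hthick⟩ := hcpt.exists_thickening_subset_open hopen hsub
    exact ⟨ρ, hρ, fun p hp ↦ (ball_subset_thickening hp ρ).trans hthick⟩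
  choose ρf hρf hρfball using hρ'
  obtain ⟨ρ, hρ, hρle⟩ := exists_pos_forall_le (fun yy' : ↥t × ↥t ↦ ρf yy'.1 yy'.2)
    fun _ ↦ hρf _ _
  -- 4. uniform continuity of the box coordinates of `f` on `S ∩ f ⁻¹ (C y)`
  have hη' : ∀ y : ↥t, ∃ η > (0 : ℝ), ∀ x ∈ S ∩ f ⁻¹' C y, ∀ x' ∈ S ∩ f ⁻¹' C y,
      dist x x' < η → dist (eOf y (f x)) (eOf y (f x')) < ρ / 4 := by
    intro y
    have hcl : IsClosed (S ∩ f ⁻¹' C y) :=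
      hf.preimage_isClosed_of_isClosed isClosed_closedBall (hCcpt y).isClosed
    have hcpt : IsCompact (S ∩ f ⁻¹' C y) := hS.of_isClosed_subset hcl inter_subset_left
    have hcont : ContinuousOn (fun x ↦ eOf y (f x)) (S ∩ f ⁻¹' C y) :=
      (eOf (y : M)).continuousOn.comp (hf.mono inter_subset_left) fun x hx ↦ hCsrc y hx.2
    obtain ⟨η, hη, h⟩ := Metric.uniformContinuousOn_iff.1
      (hcpt.uniformContinuousOn_of_continuous hcont) (ρ / 4) (by positivity)
    exact ⟨η, hη, fun x hx x' hx' hd ↦ h x hx x' hx' hd⟩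
  choose ηf hηf hηfd using hη'
  obtain ⟨η, hη, hηle⟩ := exists_pos_forall_le ηf hηf
  -- 5. the mesh: `5 ℓ < min δ₁ η`
  have hm : 0 < min δ₁ η := lt_min hδ₁ hη
  obtain ⟨n, hn⟩ := exists_nat_gt (5 * L / min δ₁ η)
  have hn₀' : (0 : ℝ) < n := lt_of_le_of_lt (by positivity) hn
  have hn₀ : 0 < n := Nat.cast_pos.1 hn₀'
  set g : Grid := grid c₀ hL hn₀ with hgdef
  have hgS : g.S = S := grid_S hL hn₀
  have hℓ : g.ℓ = L / n := rfl
  have h5ℓ : 5 * g.ℓ < min δ₁ η := by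
    rw [div_lt_iff₀ hm] at hn
    rw [hℓ, show 5 * (L / n) = 5 * L / n by ring, div_lt_iff₀ hn₀']
    linarith [mul_comm (n : ℝ) (min δ₁ η)]
  have h5δ : 5 * g.ℓ < δ₁ := lt_of_lt_of_le h5ℓ (min_le_left _ _)
  have h3η : 3 * g.ℓ < η := by linarith [lt_of_lt_of_le h5ℓ (min_le_right _ _), g.hℓ]
  -- 6. the boxes: a Lebesgue index at each centre
  have hcS : ∀ q, g.centre q ∈ S := fun q ↦ by rw [← hgS]; exact g.sq_subset_S q (g.centre_mem_sq q)
  have hidx : ∀ q, ∃ y : ↥t, ball (g.centre q) δ₁ ⊆ U y := fun q ↦ hLeb _ (hcS q)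
  choose yq hyq using hidx
  -- the star of `Q` is mapped into `W (yq Q)`
  have hstar : ∀ q q', g.Adj q q' → ∀ x ∈ g.sq q', x ∈ S ∧ f x ∈ W (yq q) := by
    intro q q' hadj x hx
    have hxS : x ∈ S := by rw [← hgS]; exact g.sq_subset_S q' hx
    have hxball : x ∈ ball (g.centre q) δ₁ := by
      have := g.sq_subset_closedBall_of_adj hadj hx
      rw [mem_closedBall] at this
      rw [mem_ball]
      linarith
    have : x ∈ U (yq q) ∩ S := ⟨hyq q hxball, hxS⟩
    rw [← hUeq] at this
    exact ⟨hxS, this.1⟩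
  refine ⟨n, hn₀, fun q ↦ eOf (yq q), ρ, hρ, fun q ↦ heOf _, ?_, ?_⟩
  · -- sub-boxes of radius `ρ` lie in the sources of the adjacent boxes
    intro q q' hadj
    have h1 := hstar q q (g.adj_refl q) _ (g.centre_mem_sq q)
    have h2 := hstar q' q hadj.symm _ (g.centre_mem_sq q)
    have hp : eOf (yq q) (f (g.centre q)) ∈ (eOf (yq q)) '' (C (yq q) ∩ C (yq q')) :=
      mem_image_of_mem _ ⟨hWC _ h1.2, hWC _ h2.2⟩
    have hball := hρfball (yq q) (yq q') _ hp
    rintro _ ⟨p', hp', rfl⟩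
    exact hball (ball_subset_ball (hρle (yq q, yq q')) hp')
  · -- `f` of an adjacent square lies in the sub-box of radius `ρ / 4`
    intro q q' hadj x hx
    obtain ⟨hxS, hxW⟩ := hstar q q' hadj x hx
    obtain ⟨hcS', hcW⟩ := hstar q q (g.adj_refl q) _ (g.centre_mem_sq q)
    have hd : dist x (g.centre q) < ηf (yq q) := by
      have := g.sq_subset_closedBall_of_adj hadj hx
      rw [mem_closedBall] at this
      linarith [hηle (yq q)]
    have := hηfd (yq q) x ⟨hxS, hWC _ hxW⟩ (g.centre q) ⟨hcS', hWC _ hcW⟩ hd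
    rw [F.mem_subbox_iff (heOf _)]
    exact ⟨F.subbox_subset_source (heOf _) hxW, mem_ball.2 this⟩

end Foliation

/-! ## More grid combinatorics: boundary edges, owned inner edges -/

namespace SquareGrid.Grid

variable (g : Grid) {x : ℝ × ℝ} {q q' : Fin g.n × Fin g.n}

/-- The edge `k` of the square `q` is a **boundary edge** of the big square: bottom edge of the
bottom row, top edge of the top row, left edge of the left column, right edge of the right
column. [folklore] -/
def IsBoundaryEdge (q : Fin g.n × Fin g.n) (k : Fin 4) : Prop :=
  (k = 0 ∧ (q.2 : ℕ) = 0) ∨ (k = 1 ∧ (q.2 : ℕ) + 1 = g.n) ∨ (k = 2 ∧ (q.1 : ℕ) = 0) ∨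
    (k = 3 ∧ (q.1 : ℕ) + 1 = g.n)

/-- The edges are injective curves. [folklore] -/
theorem edge_injective (q : Fin g.n × Fin g.n) (k : Fin 4) : Function.Injective (g.edge q k) := by
  intro s s' h
  match k with
  | 0 => simpa using congrArg Prod.fst h
  | 1 => simpa using congrArg Prod.fst h
  | 2 => simpa using congrArg Prod.snd h
  | 3 => simpa using congrArg Prod.snd h

/-- The boundary sphere of a small square is the union of its four edges. [folklore] -/
theorem sphere_centre_eq_iUnion (q : Fin g.n × Fin g.n) :
    sphere (g.centre q) g.ℓ = ⋃ k : Fin 4, g.edge q k '' Icc 0 (2 * g.ℓ) := by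
  refine Subset.antisymm (fun x hx ↦ ?_) (iUnion_subset fun k ↦ ?_)
  · obtain ⟨k, s, hs, rfl⟩ := g.exists_edge_eq_of_mem_sphere hx
    exact mem_iUnion.2 ⟨k, mem_image_of_mem _ hs⟩
  · rintro _ ⟨s, hs, rfl⟩
    exact g.edge_mem_sphere q k hs

/-- **Every point of the boundary of the big square lies on a boundary edge.** [folklore] -/
theorem exists_isBoundaryEdge_of_mem_sphere (hx : x ∈ sphere g.bigCentre (g.n * g.ℓ)) :
    ∃ q k s, g.IsBoundaryEdge q k ∧ s ∈ Icc 0 (2 * g.ℓ) ∧ g.edge q k s = x := by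
  have hℓ := g.hℓ
  have hxS : x ∈ g.S := sphere_subset_closedBall hx
  obtain ⟨q, hq⟩ := g.exists_mem_sq hxS
  have hq' := (g.mem_sq_iff).1 hq
  obtain ⟨a₁, a₂, a₃, a₄⟩ := hq'
  have hn : ((q.1 : ℕ) : ℝ) + 1 ≤ g.n := by exact_mod_cast q.1.isLt
  have hn' : ((q.2 : ℕ) : ℝ) + 1 ≤ g.n := by exact_mod_cast q.2.isLt
  -- the big sphere in coordinates
  have hx' : x.1 = g.a.1 ∨ x.1 = g.a.1 + 2 * g.n * g.ℓ ∨ x.2 = g.a.2 ∨ x.2 = g.a.2 + 2 * g.n * g.ℓ := by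
    rw [← closedBall_sdiff_ball, Set.mem_sdiff, mem_ball, Prod.dist_eq, max_lt_iff, Real.dist_eq,
      Real.dist_eq, abs_sub_lt_iff, abs_sub_lt_iff] at hx
    simp only [bigCentre, not_and_or, not_lt] at hx
    obtain ⟨-, (h | h) | (h | h)⟩ := hx
    · right; left; nlinarith
    · left; nlinarith
    · right; right; right; nlinarith
    · right; right; left; nlinarith
  rcases hx' with h | h | h | h
  · -- left side: `q.1 = 0`, left edge
    have hq1 : (q.1 : ℕ) = 0 := by
      have : (2 * (q.1 : ℕ) : ℝ) * g.ℓ ≤ 0 := by linarith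
      have : ((q.1 : ℕ) : ℝ) ≤ 0 := by nlinarith
      exact_mod_cast le_antisymm this (Nat.cast_nonneg _)
    refine ⟨q, 2, x.2 - (g.a.2 + 2 * (q.2 : ℕ) * g.ℓ), Or.inr (Or.inr (Or.inl ⟨rfl, hq1⟩)),
      ⟨by linarith, by linarith⟩, ?_⟩
    rw [edge_two]; ext <;> simp only [hq1] <;> push_cast <;> linarith
  · -- right side
    have hq1 : (q.1 : ℕ) + 1 = g.n := by
      have : (2 * g.n : ℝ) * g.ℓ ≤ (2 * (q.1 : ℕ) + 2) * g.ℓ := by linarith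
      have : (g.n : ℝ) ≤ (q.1 : ℕ) + 1 := by nlinarith
      have : g.n ≤ (q.1 : ℕ) + 1 := by exact_mod_cast this
      have := q.1.isLt
      omega
    refine ⟨q, 3, x.2 - (g.a.2 + 2 * (q.2 : ℕ) * g.ℓ), Or.inr (Or.inr (Or.inr ⟨rfl, hq1⟩)),
      ⟨by linarith, by linarith⟩, ?_⟩
    have : (2 * ((q.1 : ℕ) : ℝ) + 2) * g.ℓ = 2 * g.n * g.ℓ := by
      rw [← Nat.cast_inj (R := ℝ)] at hq1; push_cast at hq1; rw [← hq1]; ring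
    rw [edge_three]; ext <;> simp only <;> linarith
  · -- bottom side
    have hq2 : (q.2 : ℕ) = 0 := by
      have : (2 * (q.2 : ℕ) : ℝ) * g.ℓ ≤ 0 := by linarith
      have : ((q.2 : ℕ) : ℝ) ≤ 0 := by nlinarith
      exact_mod_cast le_antisymm this (Nat.cast_nonneg _)
    refine ⟨q, 0, x.1 - (g.a.1 + 2 * (q.1 : ℕ) * g.ℓ), Or.inl ⟨rfl, hq2⟩,
      ⟨by linarith, by linarith⟩, ?_⟩
    rw [edge_zero]; ext <;> simp only [hq2] <;> push_cast <;> linarith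
  · -- top side
    have hq2 : (q.2 : ℕ) + 1 = g.n := by
      have : (2 * g.n : ℝ) * g.ℓ ≤ (2 * (q.2 : ℕ) + 2) * g.ℓ := by linarith
      have : (g.n : ℝ) ≤ (q.2 : ℕ) + 1 := by nlinarith
      have : g.n ≤ (q.2 : ℕ) + 1 := by exact_mod_cast this
      have := q.2.isLt
      omega
    refine ⟨q, 1, x.1 - (g.a.1 + 2 * (q.1 : ℕ) * g.ℓ), Or.inr (Or.inl ⟨rfl, hq2⟩),
      ⟨by linarith, by linarith⟩, ?_⟩
    have : (2 * ((q.2 : ℕ) : ℝ) + 2) * g.ℓ = 2 * g.n * g.ℓ := by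
      rw [← Nat.cast_inj (R := ℝ)] at hq2; push_cast at hq2; rw [← hq2]; ring
    rw [edge_one]; ext <;> simp only <;> linarith

/-- An **owned inner edge**: a bottom edge not on the bottom row, or a left edge not on the
left column (each inner edge of the grid is exactly one of these: the top edge of `(i, j)` is
the bottom edge of `(i, j + 1)`, the right edge of `(i, j)` is the left edge of `(i + 1, j)`).
[folklore] -/
structure OwnedEdge where
  /-- the owning square -/
  q : Fin g.n × Fin g.n
  /-- the side: `0` (bottom) or `2` (left) -/
  k : Fin 4
  owned : (k = 0 ∧ 0 < (q.2 : ℕ)) ∨ (k = 2 ∧ 0 < (q.1 : ℕ))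

namespace OwnedEdge

variable {g}

/-- The closed segment of an owned edge. [folklore] -/
def seg (E : g.OwnedEdge) : Set (ℝ × ℝ) := g.edge E.q E.k '' Icc 0 (2 * g.ℓ)

/-- The square on the **other side** of an owned edge: below a bottom edge, left of a left
edge. [folklore] -/
def other (E : g.OwnedEdge) : Fin g.n × Fin g.n :=
  if E.k = 0 then (E.q.1, ⟨(E.q.2 : ℕ) - 1, lt_of_le_of_lt (Nat.sub_le _ _) E.q.2.isLt⟩)
  else (⟨(E.q.1 : ℕ) - 1, lt_of_le_of_lt (Nat.sub_le _ _) E.q.1.isLt⟩, E.q.2)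

/-- The other square is adjacent to the owner. [folklore] -/
theorem adj_other (E : g.OwnedEdge) : g.Adj E.q E.other := by
  unfold other Adj
  split_ifs
  · simp only
    omega
  · simp only
    omega

/-- **Two distinct owned edges meet only at their ends.** [folklore] -/
theorem endpoint_of_ne {E E' : g.OwnedEdge} (hne : E ≠ E') {s s' : ℝ} (hs : s ∈ Icc 0 (2 * g.ℓ))
    (hs' : s' ∈ Icc 0 (2 * g.ℓ)) (h : g.edge E.q E.k s = g.edge E'.q E'.k s') :
    s = 0 ∨ s = 2 * g.ℓ := by
  have hℓ := g.hℓ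
  obtain ⟨hs₀, hs₁⟩ := hs
  obtain ⟨hs₀', hs₁'⟩ := hs'
  rcases E with ⟨⟨i, j⟩, k, (⟨rfl, hk⟩ | ⟨rfl, hk⟩)⟩ <;>
    rcases E' with ⟨⟨i', j'⟩, k', (⟨rfl, hk'⟩ | ⟨rfl, hk'⟩)⟩
  · -- bottom / bottom
    rw [edge_zero, edge_zero, Prod.ext_iff] at h
    obtain ⟨h₁, h₂⟩ := h
    simp only at h₁ h₂
    have hj : ((j : ℕ) : ℝ) = (j' : ℕ) := by nlinarith
    have hj' : (j : ℕ) = j' := by exact_mod_cast hj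
    rcases lt_trichotomy (i : ℕ) i' with hi | hi | hi
    · have : ((i : ℕ) : ℝ) + 1 ≤ (i' : ℕ) := by exact_mod_cast hi
      right; nlinarith
    · exfalso
      have hii : i = i' := Fin.ext hi
      have hjj : j = j' := Fin.ext hj'
      subst hii hjj
      exact hne rfl
    · have : ((i' : ℕ) : ℝ) + 1 ≤ (i : ℕ) := by exact_mod_cast hi
      left; nlinarith
  · -- bottom / left
    rw [edge_zero, edge_two, Prod.ext_iff] at h
    obtain ⟨h₁, h₂⟩ := h
    simp only at h₁ h₂
    have e₁ : s = 2 * g.ℓ * ((i' : ℕ) - (i : ℕ) : ℝ) := by linarith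
    have lo : ((i : ℕ) : ℝ) ≤ (i' : ℕ) := by nlinarith
    have hi : ((i' : ℕ) : ℝ) ≤ (i : ℕ) + 1 := by nlinarith
    have lo' : (i : ℕ) ≤ i' := by exact_mod_cast lo
    have hi' : (i' : ℕ) ≤ (i : ℕ) + 1 := by exact_mod_cast hi
    rcases Nat.eq_or_lt_of_le lo' with heq | hlt
    · left; rw [e₁, heq]; ring
    · right
      have : (i' : ℕ) = (i : ℕ) + 1 := by omega
      rw [e₁, this]; push_cast; ring
  · -- left / bottom
    rw [edge_two, edge_zero, Prod.ext_iff] at h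
    obtain ⟨h₁, h₂⟩ := h
    simp only at h₁ h₂
    have e₁ : s = 2 * g.ℓ * ((j' : ℕ) - (j : ℕ) : ℝ) := by linarith
    have lo : ((j : ℕ) : ℝ) ≤ (j' : ℕ) := by nlinarith
    have hi : ((j' : ℕ) : ℝ) ≤ (j : ℕ) + 1 := by nlinarith
    have lo' : (j : ℕ) ≤ j' := by exact_mod_cast lo
    have hi' : (j' : ℕ) ≤ (j : ℕ) + 1 := by exact_mod_cast hi
    rcases Nat.eq_or_lt_of_le lo' with heq | hlt
    · left; rw [e₁, heq]; ring
    · right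
      have : (j' : ℕ) = (j : ℕ) + 1 := by omega
      rw [e₁, this]; push_cast; ring
  · -- left / left
    rw [edge_two, edge_two, Prod.ext_iff] at h
    obtain ⟨h₁, h₂⟩ := h
    simp only at h₁ h₂
    have hi : ((i : ℕ) : ℝ) = (i' : ℕ) := by nlinarith
    have hi' : (i : ℕ) = i' := by exact_mod_cast hi
    rcases lt_trichotomy (j : ℕ) j' with hj | hj | hj
    · have : ((j : ℕ) : ℝ) + 1 ≤ (j' : ℕ) := by exact_mod_cast hj
      right; nlinarith
    · exfalso
      have hii : i = i' := Fin.ext hi'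
      have hjj : j = j' := Fin.ext hj
      subst hii hjj
      exact hne rfl
    · have : ((j' : ℕ) : ℝ) + 1 ≤ (j : ℕ) := by exact_mod_cast hj
      left; nlinarith

/-- **An owned edge meets a boundary edge only at its ends.** [folklore] -/
theorem endpoint_of_isBoundaryEdge {q : Fin g.n × Fin g.n} {k₀ : Fin 4} (hb : g.IsBoundaryEdge q k₀)
    {s₀ : ℝ} (hs₀ : s₀ ∈ Icc 0 (2 * g.ℓ)) {E : g.OwnedEdge} {s : ℝ} (hs : s ∈ Icc 0 (2 * g.ℓ))
    (h : g.edge E.q E.k s = g.edge q k₀ s₀) : s = 0 ∨ s = 2 * g.ℓ := by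
  have hℓ := g.hℓ
  obtain ⟨hs₀', hs₁'⟩ := hs₀
  obtain ⟨hs₀, hs₁⟩ := hs
  have hqn₁ : ((E.q.1 : ℕ) : ℝ) + 1 ≤ g.n := by exact_mod_cast E.q.1.isLt
  have hqn₂ : ((E.q.2 : ℕ) : ℝ) + 1 ≤ g.n := by exact_mod_cast E.q.2.isLt
  rcases hb with ⟨rfl, hq⟩ | ⟨rfl, hq⟩ | ⟨rfl, hq⟩ | ⟨rfl, hq⟩
  · -- bottom boundary: `x.2 = a.2`
    have h₂ := congrArg Prod.snd h
    rw [edge_zero] at h₂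
    simp only [hq, Nat.cast_zero, mul_zero, zero_mul, add_zero] at h₂
    rcases E with ⟨⟨i, j⟩, k, (⟨rfl, hk⟩ | ⟨rfl, hk⟩)⟩
    · exfalso
      rw [edge_zero] at h₂
      simp only at h₂
      have : (1 : ℝ) ≤ (j : ℕ) := by exact_mod_cast hk
      nlinarith
    · left
      rw [edge_two] at h₂
      simp only at h₂
      have : (0 : ℝ) ≤ (j : ℕ) := Nat.cast_nonneg _
      nlinarith
  · -- top boundary: `x.2 = a.2 + 2 n ℓ`
    have h₂ := congrArg Prod.snd h
    rw [edge_one] at h₂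
    have hq' : (2 * ((q.2 : ℕ) : ℝ) + 2) * g.ℓ = 2 * g.n * g.ℓ := by
      rw [← Nat.cast_inj (R := ℝ)] at hq; push_cast at hq; rw [← hq]; ring
    simp only [hq'] at h₂
    rcases E with ⟨⟨i, j⟩, k, (⟨rfl, hk⟩ | ⟨rfl, hk⟩)⟩
    · exfalso
      rw [edge_zero] at h₂
      simp only at h₂
      have : ((j : ℕ) : ℝ) + 1 ≤ g.n := by exact_mod_cast j.isLt
      nlinarith
    · right
      rw [edge_two] at h₂
      simp only at h₂
      have : ((j : ℕ) : ℝ) + 1 ≤ g.n := by exact_mod_cast j.isLt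
      nlinarith
  · -- left boundary: `x.1 = a.1`
    have h₁ := congrArg Prod.fst h
    rw [edge_two] at h₁
    simp only [hq, Nat.cast_zero, mul_zero, zero_mul, add_zero] at h₁
    rcases E with ⟨⟨i, j⟩, k, (⟨rfl, hk⟩ | ⟨rfl, hk⟩)⟩
    · left
      rw [edge_zero] at h₁
      simp only at h₁
      have : (0 : ℝ) ≤ (i : ℕ) := Nat.cast_nonneg _
      nlinarith
    · exfalso
      rw [edge_two] at h₁
      simp only at h₁
      have : (1 : ℝ) ≤ (i : ℕ) := by exact_mod_cast hk
      nlinarith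
  · -- right boundary: `x.1 = a.1 + 2 n ℓ`
    have h₁ := congrArg Prod.fst h
    rw [edge_three] at h₁
    have hq' : (2 * ((q.1 : ℕ) : ℝ) + 2) * g.ℓ = 2 * g.n * g.ℓ := by
      rw [← Nat.cast_inj (R := ℝ)] at hq; push_cast at hq; rw [← hq]; ring
    simp only [hq'] at h₁
    rcases E with ⟨⟨i, j⟩, k, (⟨rfl, hk⟩ | ⟨rfl, hk⟩)⟩
    · right
      rw [edge_zero] at h₁
      simp only at h₁
      have : ((i : ℕ) : ℝ) + 1 ≤ g.n := by exact_mod_cast i.isLt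
      nlinarith
    · exfalso
      rw [edge_two] at h₁
      simp only at h₁
      have : ((i : ℕ) : ℝ) + 1 ≤ g.n := by exact_mod_cast i.isLt
      nlinarith

end OwnedEdge

/-- The bottom edge of a square not on the bottom row, as an owned edge. [folklore] -/
def ownedBottom (q : Fin g.n × Fin g.n) (h : 0 < (q.2 : ℕ)) : g.OwnedEdge := ⟨q, 0, Or.inl ⟨rfl, h⟩⟩

/-- The left edge of a square not on the left column, as an owned edge. [folklore] -/
def ownedLeft (q : Fin g.n × Fin g.n) (h : 0 < (q.1 : ℕ)) : g.OwnedEdge := ⟨q, 2, Or.inr ⟨rfl, h⟩⟩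

/-- The square above. [folklore] -/
def up (q : Fin g.n × Fin g.n) (h : (q.2 : ℕ) + 1 < g.n) : Fin g.n × Fin g.n := (q.1, ⟨q.2 + 1, h⟩)

/-- The square to the right. [folklore] -/
def right (q : Fin g.n × Fin g.n) (h : (q.1 : ℕ) + 1 < g.n) : Fin g.n × Fin g.n := (⟨q.1 + 1, h⟩, q.2)

/-- The top edge is the bottom edge of the square above. [folklore] -/
theorem edge_one_eq_edge_up (q : Fin g.n × Fin g.n) (h : (q.2 : ℕ) + 1 < g.n) :
    g.edge q 1 = g.edge (g.up q h) 0 :=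
  g.edge_top_eq (i := q.1) (j := q.2) (j' := ⟨q.2 + 1, h⟩) rfl

/-- The right edge is the left edge of the square to the right. [folklore] -/
theorem edge_three_eq_edge_right (q : Fin g.n × Fin g.n) (h : (q.1 : ℕ) + 1 < g.n) :
    g.edge q 3 = g.edge (g.right q h) 2 :=
  g.edge_right_eq (i := q.1) (i' := ⟨q.1 + 1, h⟩) (j := q.2) rfl

/-- The other square of the bottom edge of the square above `q` is `q`. [folklore] -/
theorem other_ownedBottom_up (q : Fin g.n × Fin g.n) (h : (q.2 : ℕ) + 1 < g.n) :
    (g.ownedBottom (g.up q h) (Nat.succ_pos _)).other = q := by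
  simp [OwnedEdge.other, ownedBottom, up]

/-- The other square of the left edge of the square right of `q` is `q`. [folklore] -/
theorem other_ownedLeft_right (q : Fin g.n × Fin g.n) (h : (q.1 : ℕ) + 1 < g.n) :
    (g.ownedLeft (g.right q h) (Nat.succ_pos _)).other = q := by
  simp [OwnedEdge.other, ownedLeft, right]

/-- **Classification of the sides of a square**: each side is a boundary edge, an owned edge
of the square, or the owned edge of the square above / to the right. [folklore] -/
theorem side_cases (q : Fin g.n × Fin g.n) (k : Fin 4) :
    g.IsBoundaryEdge q k ∨ (∃ _ : 0 < (q.2 : ℕ), k = 0) ∨ (∃ _ : 0 < (q.1 : ℕ), k = 2) ∨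
      (∃ _ : (q.2 : ℕ) + 1 < g.n, k = 1) ∨ (∃ _ : (q.1 : ℕ) + 1 < g.n, k = 3) := by
  have h1 := q.1.isLt
  have h2 := q.2.isLt
  match k with
  | 0 =>
    by_cases h : (q.2 : ℕ) = 0
    · exact Or.inl (Or.inl ⟨rfl, h⟩)
    · exact Or.inr (Or.inl ⟨Nat.pos_of_ne_zero h, rfl⟩)
  | 1 =>
    by_cases h : (q.2 : ℕ) + 1 = g.n
    · exact Or.inl (Or.inr (Or.inl ⟨rfl, h⟩))
    · exact Or.inr (Or.inr (Or.inr (Or.inl ⟨by omega, rfl⟩)))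
  | 2 =>
    by_cases h : (q.1 : ℕ) = 0
    · exact Or.inl (Or.inr (Or.inr (Or.inl ⟨rfl, h⟩)))
    · exact Or.inr (Or.inr (Or.inl ⟨Nat.pos_of_ne_zero h, rfl⟩))
  | 3 =>
    by_cases h : (q.1 : ℕ) + 1 = g.n
    · exact Or.inl (Or.inr (Or.inr (Or.inr ⟨rfl, h⟩)))
    · exact Or.inr (Or.inr (Or.inr (Or.inr ⟨by omega, rfl⟩)))

/-- The **parameter of a point on a side**: the arc length from the start of the edge (first
coordinate for horizontal sides, second for vertical sides). [folklore] -/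
def edgeParam (q : Fin g.n × Fin g.n) (k : Fin 4) (x : ℝ × ℝ) : ℝ :=
  match k with
  | 0 => x.1 - (g.a.1 + 2 * (q.1 : ℕ) * g.ℓ)
  | 1 => x.1 - (g.a.1 + 2 * (q.1 : ℕ) * g.ℓ)
  | 2 => x.2 - (g.a.2 + 2 * (q.2 : ℕ) * g.ℓ)
  | 3 => x.2 - (g.a.2 + 2 * (q.2 : ℕ) * g.ℓ)

/-- The parameter of the point of parameter `s` is `s`. [folklore] -/
@[simp] theorem edgeParam_edge (q : Fin g.n × Fin g.n) (k : Fin 4) (s : ℝ) :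
    g.edgeParam q k (g.edge q k s) = s := by
  match k with
  | 0 => simp [edgeParam]
  | 1 => simp [edgeParam]
  | 2 => simp [edgeParam]
  | 3 => simp [edgeParam]

/-- The parameter is a continuous function of the point. [folklore] -/
theorem continuous_edgeParam (q : Fin g.n × Fin g.n) (k : Fin 4) : Continuous (g.edgeParam q k) := by
  match k with
  | 0 => exact continuous_fst.sub continuous_const
  | 1 => exact continuous_fst.sub continuous_const
  | 2 => exact continuous_snd.sub continuous_const
  | 3 => exact continuous_snd.sub continuous_const

end SquareGrid.Grid

/-! ## Taming the 1-skeleton -/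

namespace Foliation

open SquareGrid SquareGrid.Grid

variable {B : Type*} [NormedAddCommGroup B] [NormedSpace ℝ B] {M : Type*} [TopologicalSpace M]
variable (F : Foliation B M) {e e' : OpenPartialHomeomorph M (B × ℝ)} {p p' : B × ℝ} {ρ : ℝ}

omit [NormedSpace ℝ B] in
/-- Sub-boxes increase with the radius. [folklore] -/
theorem subbox_mono (e : OpenPartialHomeomorph M (B × ℝ)) (p : B × ℝ) {ρ ρ' : ℝ} (h : ρ ≤ ρ') :
    subbox e p ρ ⊆ subbox e p ρ' :=
  image_mono (ball_subset_ball h)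

omit [NormedSpace ℝ B] in
/-- **Tame modification of a curve inside a sub-box, with fixed ends** (Camacho–Lins Neto,
Ch. VI §2 Lemma 1 and §3 Prop. 1, first step, in class `C⁰`): a curve `c` on `[a, b]` running
in the sub-box of radius `ρ / 4` of `e` and in the sub-box of radius `ρ / 2` of `e'` is
replaced by the curve with the same `B`-coordinate in `e` and a tame height `ε`-close to the
old one; for `ε` below `ρ / 4` and below a thickening radius, the new curve has the same ends,
runs in both sub-boxes of radius `ρ / 2`, and its `e`-height is tame.
[cite: CamachoLinsNeto1985, Ch. VI §3 Prop. 1] -/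
theorem exists_tame_modification (he : e ∈ F.atlas) (he' : e' ∈ F.atlas) {a b : ℝ} (hab : a ≤ b)
    (hρ : 0 < ρ) {c : ℝ → M} (hc : ContinuousOn c (Icc a b))
    (hce : ∀ s ∈ Icc a b, c s ∈ subbox e p (ρ / 4)) (hce' : ∀ s ∈ Icc a b, c s ∈ subbox e' p' (ρ / 2)) :
    ∃ μ : ℝ → M, ContinuousOn μ (Icc a b) ∧ μ a = c a ∧ μ b = c b ∧
      (∀ s ∈ Icc a b, μ s ∈ subbox e p (ρ / 2)) ∧ (∀ s ∈ Icc a b, μ s ∈ subbox e' p' (ρ / 2)) ∧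
      TameFunction.IsTameOn (fun s ↦ height e (μ s)) a b := by
  have hcsrc : ∀ s ∈ Icc a b, c s ∈ e.source := fun s hs ↦ F.subbox_subset_source he (hce s hs)
  have hΦ : ContinuousOn (fun s ↦ e (c s)) (Icc a b) := e.continuousOn.comp hc hcsrc
  -- thickening radius keeping `e.symm` of nearby box points inside the sub-box of `e'`
  have hK : IsCompact ((fun s ↦ e (c s)) '' Icc a b) := isCompact_Icc.image_of_continuousOn hΦ
  have hO : IsOpen (e.symm ⁻¹' subbox e' p' (ρ / 2)) :=
    (F.continuous_symm_of_mem he).isOpen_preimage _ (F.isOpen_subbox he')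
  have hKO : (fun s ↦ e (c s)) '' Icc a b ⊆ e.symm ⁻¹' subbox e' p' (ρ / 2) := by
    rintro _ ⟨s, hs, rfl⟩
    show e.symm (e (c s)) ∈ subbox e' p' (ρ / 2)
    rw [e.left_inv (hcsrc s hs)]
    exact hce' s hs
  obtain ⟨θ, hθ, hthick⟩ := hK.exists_thickening_subset_open hO hKO
  -- tame approximation of the height with error `< min (ρ / 4) θ`, same end values
  have hε : 0 < min (ρ / 4) θ := lt_min (by positivity) hθ
  obtain ⟨ψ, hψt, hψa, hψb, hψε⟩ := TameFunction.exists_isTameOn_approx hab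
    (f := fun s ↦ (e (c s)).2) (continuous_snd.comp_continuousOn hΦ) hε
  have hclose : ∀ s ∈ Icc a b, ((e (c s)).1, ψ s) ∈ ball (e (c s)) (min (ρ / 4) θ) := fun s hs ↦ by
    simp only [mem_ball, Prod.dist_eq, dist_self, max_lt_iff]
    exact ⟨hε, by rw [Real.dist_eq]; exact hψε s hs⟩
  have htarget : ∀ v : B × ℝ, v ∈ e.target := fun v ↦ by rw [F.target_eq e he]; exact mem_univ _
  refine ⟨fun s ↦ e.symm ((e (c s)).1, ψ s), ?_, ?_, ?_, fun s hs ↦ ?_, fun s hs ↦ ?_, ?_⟩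
  · exact (F.continuous_symm_of_mem he).comp_continuousOn
      ((continuous_fst.comp_continuousOn hΦ).prodMk hψt.1)
  · show e.symm ((e (c a)).1, ψ a) = c a
    rw [hψa, Prod.mk.eta, e.left_inv (hcsrc a ⟨le_rfl, hab⟩)]
  · show e.symm ((e (c b)).1, ψ b) = c b
    rw [hψb, Prod.mk.eta, e.left_inv (hcsrc b ⟨hab, le_rfl⟩)]
  · refine symm_mem_subbox (mem_ball.2 ?_)
    have h₁ : dist ((e (c s)).1, ψ s) (e (c s)) < ρ / 4 :=
      lt_of_lt_of_le (mem_ball.1 (hclose s hs)) (min_le_left _ _)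
    have h₂ : dist (e (c s)) p < ρ / 4 := mem_ball.1 (F.apply_mem_ball_of_mem_subbox he (hce s hs))
    linarith [dist_triangle ((e (c s)).1, ψ s) (e (c s)) p]
  · have : ((e (c s)).1, ψ s) ∈ thickening θ ((fun s ↦ e (c s)) '' Icc a b) :=
      ball_subset_thickening (mem_image_of_mem _ hs) θ (ball_subset_ball (min_le_right _ _) (hclose s hs))
    exact hthick this
  · have : (fun s ↦ height e (e.symm ((e (c s)).1, ψ s))) = ψ := by
      funext s
      rw [height_apply, e.right_inv (htarget _)]
    rw [this]
    exact hψt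

variable {F} in
/-- **Taming the 1-skeleton** (Camacho–Lins Neto, Ch. VI §3 Prop. 1, the step making the map
nice on the 1-skeleton of a fine subdivision, in class `C⁰`). Given a grid, flow boxes `e_Q`
and a radius `ρ` as in `exists_boxes`, a map `f` continuous on the big square whose heights
along the boundary edges are tame, there is a map `g₁` of the plane with: `g₁ = f` on the
boundary edges; `g₁` continuous on the boundary of every square; `g₁` of every edge of `Q`
inside the sub-box of `e_Q` of radius `ρ / 2`; and the `e_Q`-height of `g₁` tame along every
edge of `Q`. (Each inner edge is modified once, by its owner, inside the sub-boxes of both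
adjacent squares; tameness in the other box follows from
`IsTransverselyOriented.isTameOn_height_of_subbox`.) [cite: CamachoLinsNeto1985, Ch. VI §3 Prop. 1] -/
theorem IsTransverselyOriented.exists_tame_skeleton (ho : F.IsTransverselyOriented) (g : Grid)
    {box : Fin g.n × Fin g.n → OpenPartialHomeomorph M (B × ℝ)} (hbox : ∀ q, box q ∈ F.atlas)
    (hρ : 0 < ρ) {f : ℝ × ℝ → M} (hf : ContinuousOn f g.S)
    (hsrc : ∀ q q', g.Adj q q' → subbox (box q) (box q (f (g.centre q))) ρ ⊆ (box q').source)
    (hf4 : ∀ q q', g.Adj q q' → ∀ x ∈ g.sq q',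
      f x ∈ subbox (box q) (box q (f (g.centre q))) (ρ / 4))
    (hbd : ∀ q k, g.IsBoundaryEdge q k →
      TameFunction.IsTameOn (fun s ↦ height (box q) (f (g.edge q k s))) 0 (2 * g.ℓ)) :
    ∃ g₁ : ℝ × ℝ → M,
      (∀ q k, g.IsBoundaryEdge q k → ∀ s ∈ Icc 0 (2 * g.ℓ), g₁ (g.edge q k s) = f (g.edge q k s)) ∧
      (∀ q, ContinuousOn g₁ (sphere (g.centre q) g.ℓ)) ∧
      (∀ q k, ∀ s ∈ Icc 0 (2 * g.ℓ),
        g₁ (g.edge q k s) ∈ subbox (box q) (box q (f (g.centre q))) (ρ / 2)) ∧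
      (∀ q k, TameFunction.IsTameOn (fun s ↦ height (box q) (g₁ (g.edge q k s))) 0 (2 * g.ℓ)) := by
  have h2ℓ : (0 : ℝ) ≤ 2 * g.ℓ := by linarith [g.hℓ]
  -- the modification on each owned edge
  have hmod : ∀ E : g.OwnedEdge, ∃ μ : ℝ → M, ContinuousOn μ (Icc 0 (2 * g.ℓ)) ∧
      μ 0 = f (g.edge E.q E.k 0) ∧ μ (2 * g.ℓ) = f (g.edge E.q E.k (2 * g.ℓ)) ∧
      (∀ s ∈ Icc 0 (2 * g.ℓ), μ s ∈ subbox (box E.q) (box E.q (f (g.centre E.q))) (ρ / 2)) ∧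
      (∀ s ∈ Icc 0 (2 * g.ℓ),
        μ s ∈ subbox (box E.other) (box E.other (f (g.centre E.other))) (ρ / 2)) ∧
      TameFunction.IsTameOn (fun s ↦ height (box E.q) (μ s)) 0 (2 * g.ℓ) := by
    intro E
    refine F.exists_tame_modification (hbox E.q) (hbox E.other) h2ℓ hρ
      (c := fun s ↦ f (g.edge E.q E.k s)) ?_ ?_ ?_
    · exact hf.comp (g.continuous_edge E.q E.k).continuousOn
        fun s hs ↦ g.sq_subset_S _ (g.edge_mem_sq E.q E.k hs)
    · exact fun s hs ↦ hf4 E.q E.q (g.adj_refl _) _ (g.edge_mem_sq E.q E.k hs)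
    · exact fun s hs ↦ subbox_mono _ _ (by linarith)
        (hf4 E.other E.q E.adj_other.symm _ (g.edge_mem_sq E.q E.k hs))
  choose μ hμc hμ0 hμ1 hμq hμo hμt using hmod
  have hends : ∀ E : g.OwnedEdge, ∀ s, s = 0 ∨ s = 2 * g.ℓ → μ E s = f (g.edge E.q E.k s) := by
    rintro E s (rfl | rfl)
    exacts [hμ0 E, hμ1 E]
  -- the chosen edge and parameter through a point of the owned skeleton
  have hchoice : ∀ x : ℝ × ℝ, (∃ E : g.OwnedEdge, x ∈ E.seg) →
      ∃ (E : g.OwnedEdge) (s : ℝ), s ∈ Icc 0 (2 * g.ℓ) ∧ g.edge E.q E.k s = x :=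
    fun x ⟨E, s, hs, h⟩ ↦ ⟨E, s, hs, h⟩
  choose Eof sof hsof hEof using hchoice
  classical
  set g₁ : ℝ × ℝ → M := fun x ↦ if h : ∃ E : g.OwnedEdge, x ∈ E.seg then μ (Eof x h) (sof x h) else f x
    with hg₁
  -- `g₁` on an owned edge is its modification
  have key : ∀ E : g.OwnedEdge, ∀ s ∈ Icc 0 (2 * g.ℓ), g₁ (g.edge E.q E.k s) = μ E s := by
    intro E s hs
    have hex : ∃ E' : g.OwnedEdge, g.edge E.q E.k s ∈ E'.seg := ⟨E, mem_image_of_mem _ hs⟩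
    rw [hg₁]
    simp only [dif_pos hex]
    have hs' := hsof _ hex
    have heq := hEof _ hex
    generalize Eof _ hex = E' at hs' heq ⊢
    generalize sof _ hex = s' at hs' heq ⊢
    by_cases hEE : E' = E
    · subst hEE
      rw [g.edge_injective _ _ heq]
    · rw [hends E' s' (OwnedEdge.endpoint_of_ne hEE hs' hs heq),
        hends E s (OwnedEdge.endpoint_of_ne (Ne.symm hEE) hs hs' heq.symm), heq]
  -- `g₁ = f` on boundary edges
  have hbdry : ∀ q k, g.IsBoundaryEdge q k → ∀ s ∈ Icc 0 (2 * g.ℓ),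
      g₁ (g.edge q k s) = f (g.edge q k s) := by
    intro q k hb s hs
    rw [hg₁]
    simp only
    split_ifs with hex
    · have hs' := hsof _ hex
      have heq := hEof _ hex
      generalize Eof _ hex = E' at hs' heq ⊢
      generalize sof _ hex = s' at hs' heq ⊢
      rw [hends E' s' (OwnedEdge.endpoint_of_isBoundaryEdge hb hs hs' heq), heq]
    · rfl
  -- on each side of each square, `g₁` is a nice curve
  have hside : ∀ q k, ∃ ν : ℝ → M, (∀ s ∈ Icc 0 (2 * g.ℓ), g₁ (g.edge q k s) = ν s) ∧
      ContinuousOn ν (Icc 0 (2 * g.ℓ)) ∧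
      (∀ s ∈ Icc 0 (2 * g.ℓ), ν s ∈ subbox (box q) (box q (f (g.centre q))) (ρ / 2)) ∧
      TameFunction.IsTameOn (fun s ↦ height (box q) (ν s)) 0 (2 * g.ℓ) := by
    intro q k
    rcases g.side_cases q k with hb | ⟨h, rfl⟩ | ⟨h, rfl⟩ | ⟨h, rfl⟩ | ⟨h, rfl⟩
    · -- boundary edge: unchanged
      refine ⟨fun s ↦ f (g.edge q k s), hbdry q k hb, ?_, fun s hs ↦ ?_, hbd q k hb⟩
      · exact hf.comp (g.continuous_edge q k).continuousOn
          fun s hs ↦ g.sq_subset_S _ (g.edge_mem_sq q k hs)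
      · exact subbox_mono _ _ (by linarith) (hf4 q q (g.adj_refl _) _ (g.edge_mem_sq q k hs))
    · -- owned bottom edge
      exact ⟨μ (g.ownedBottom q h), key (g.ownedBottom q h), hμc _, hμq (g.ownedBottom q h),
        hμt (g.ownedBottom q h)⟩
    · -- owned left edge
      exact ⟨μ (g.ownedLeft q h), key (g.ownedLeft q h), hμc _, hμq (g.ownedLeft q h),
        hμt (g.ownedLeft q h)⟩
    · -- top edge: owned by the square above
      set E : g.OwnedEdge := g.ownedBottom (g.up q h) (Nat.succ_pos _) with hE
      have hoth : E.other = q := g.other_ownedBottom_up q h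
      have hsub : subbox (box E.q) (box E.q (f (g.centre E.q))) (ρ / 2) ⊆ (box q).source := by
        refine (subbox_mono _ _ (show ρ / 2 ≤ ρ by linarith)).trans ?_
        have := hsrc E.q E.other E.adj_other
        rwa [hoth] at this
      refine ⟨μ E, fun s hs ↦ ?_, hμc E, fun s hs ↦ ?_, ?_⟩
      · rw [g.edge_one_eq_edge_up q h]
        exact key E s hs
      · have := hμo E s hs
        rwa [hoth] at this
      · exact ho.isTameOn_height_of_subbox (hbox E.q) (hbox q) hsub (hμq E) (hμt E)
    · -- right edge: owned by the square to the right
      set E : g.OwnedEdge := g.ownedLeft (g.right q h) (Nat.succ_pos _) with hE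
      have hoth : E.other = q := g.other_ownedLeft_right q h
      have hsub : subbox (box E.q) (box E.q (f (g.centre E.q))) (ρ / 2) ⊆ (box q).source := by
        refine (subbox_mono _ _ (show ρ / 2 ≤ ρ by linarith)).trans ?_
        have := hsrc E.q E.other E.adj_other
        rwa [hoth] at this
      refine ⟨μ E, fun s hs ↦ ?_, hμc E, fun s hs ↦ ?_, ?_⟩
      · rw [g.edge_three_eq_edge_right q h]
        exact key E s hs
      · have := hμo E s hs
        rwa [hoth] at this
      · exact ho.isTameOn_height_of_subbox (hbox E.q) (hbox q) hsub (hμq E) (hμt E)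
  choose ν hν hνc hνsub hνt using hside
  refine ⟨g₁, hbdry, fun q ↦ ?_, fun q k s hs ↦ (hν q k s hs).symm ▸ hνsub q k s hs, fun q k ↦
    (hνt q k).congr fun s hs ↦ congrArg (height (box q)) (hν q k s hs).symm⟩
  -- continuity on the boundary of a square: on each closed side, `g₁ = ν ∘ edgeParam`
  rw [g.sphere_centre_eq_iUnion q]
  refine LocallyFinite.continuousOn_iUnion (locallyFinite_of_finite _)
    (fun k ↦ (isCompact_Icc.image (g.continuous_edge q k)).isClosed) fun k ↦ ?_
  have hcomp : ContinuousOn (fun x ↦ ν q k (g.edgeParam q k x)) (g.edge q k '' Icc 0 (2 * g.ℓ)) := by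
    refine (hνc q k).comp (g.continuous_edgeParam q k).continuousOn ?_
    rintro _ ⟨s, hs, rfl⟩
    rwa [g.edgeParam_edge]
  refine hcomp.congr ?_
  rintro _ ⟨s, hs, rfl⟩
  show g₁ _ = ν q k (g.edgeParam q k (g.edge q k s))
  rw [g.edgeParam_edge]
  exact hν q k s hs

/-! ## Filling the squares by cones -/

section Cones

variable (g : Grid) (box : Fin g.n × Fin g.n → OpenPartialHomeomorph M (B × ℝ))
  (ctr : Fin g.n × Fin g.n → B × ℝ) (m : Fin g.n × Fin g.n → ℝ) (g₁ : ℝ × ℝ → M)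

/-- **The cone filling** of a skeleton map `g₁`: on the square `Q`, read `g₁|∂Q` in the box
`e_Q`, fill by the cone interpolation from the apex value `((ctr Q).1, m Q)`
(`ConeSquare.cone`), and map back by `e_Q.symm`; outside the big square, `g₁` itself. (On a
common side of two squares both cones equal `g₁`, so the choice of the square is immaterial:
`coneMap_eq`.) [folklore] -/
noncomputable def coneMap (x : ℝ × ℝ) : M := by
  classical
  exact if h : ∃ q, x ∈ g.sq q then (box h.choose).symm (ConeSquare.cone (g.centre h.choose) g.ℓ
    ((ctr h.choose).1, m h.choose) (fun y ↦ box h.choose (g₁ y)) x) else g₁ x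

variable {g box ctr m g₁}

/-- **The cone filling on a square** is the cone of that square, whichever square containing
the point was chosen in the definition. [folklore] -/
theorem coneMap_eq (hsrc : ∀ q, ∀ x ∈ sphere (g.centre q) g.ℓ, g₁ x ∈ (box q).source) {q : Fin g.n × Fin g.n}
    {x : ℝ × ℝ} (hx : x ∈ g.sq q) :
    coneMap g box ctr m g₁ x = (box q).symm (ConeSquare.cone (g.centre q) g.ℓ ((ctr q).1, m q)
      (fun y ↦ box q (g₁ y)) x) := by
  classical
  have h : ∃ q, x ∈ g.sq q := ⟨q, hx⟩
  rw [coneMap, dif_pos h]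
  by_cases hq : h.choose = q
  · rw [hq]
  · -- `x` is on the boundary of both squares, where both cones equal `g₁ x`
    have hx' : x ∈ sphere (g.centre h.choose) g.ℓ := g.mem_sphere_of_mem_sq_of_ne hq h.choose_spec hx
    have hx'' : x ∈ sphere (g.centre q) g.ℓ := g.mem_sphere_of_mem_sq_of_ne (Ne.symm hq) hx h.choose_spec
    rw [ConeSquare.cone_of_mem_sphere g.hℓ hx', ConeSquare.cone_of_mem_sphere g.hℓ hx'',
      (box _).left_inv (hsrc _ x hx'), (box q).left_inv (hsrc q x hx'')]

/-- **The cone filling equals the skeleton map on the boundary of every square.** [folklore] -/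
theorem coneMap_of_mem_sphere (hsrc : ∀ q, ∀ x ∈ sphere (g.centre q) g.ℓ, g₁ x ∈ (box q).source)
    {q : Fin g.n × Fin g.n} {x : ℝ × ℝ} (hx : x ∈ sphere (g.centre q) g.ℓ) :
    coneMap g box ctr m g₁ x = g₁ x := by
  rw [coneMap_eq hsrc (g.sphere_subset_sq q hx), ConeSquare.cone_of_mem_sphere g.hℓ hx,
    (box q).left_inv (hsrc q x hx)]

/-- **The cone filling is continuous on the big square** when the skeleton map is continuous
on the boundary of every square (with values in the sources of the boxes). [folklore] -/
theorem continuousOn_coneMap (hbox : ∀ q, box q ∈ F.atlas)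
    (hsrc : ∀ q, ∀ x ∈ sphere (g.centre q) g.ℓ, g₁ x ∈ (box q).source)
    (hcont : ∀ q, ContinuousOn g₁ (sphere (g.centre q) g.ℓ)) :
    ContinuousOn (coneMap g box ctr m g₁) g.S := by
  rw [← g.iUnion_sq]
  refine LocallyFinite.continuousOn_iUnion (locallyFinite_of_finite _) (fun q ↦ isClosed_closedBall)
    fun q ↦ ?_
  have hφ : ContinuousOn (fun y ↦ box q (g₁ y)) (sphere (g.centre q) g.ℓ) :=
    (box q).continuousOn.comp (hcont q) (hsrc q)
  have hc : ContinuousOn (fun x ↦ (box q).symm (ConeSquare.cone (g.centre q) g.ℓ ((ctr q).1, m q)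
      (fun y ↦ box q (g₁ y)) x)) (g.sq q) :=
    (F.continuous_symm_of_mem (hbox q)).comp_continuousOn (ConeSquare.continuousOn_cone g.hℓ hφ)
  exact hc.congr fun x hx ↦ coneMap_eq hsrc hx

/-- **The cone filling of a square stays in its sub-box**: if the skeleton map sends `∂Q`
into the sub-box of `e_Q` of radius `ρ / 2` about `ctr Q` and the apex height is within
`ρ / 2` of `(ctr Q).2`, then the filling sends `Q` into that sub-box (balls of the box are
convex). [folklore] -/
theorem coneMap_mem_subbox (hbox : ∀ q, box q ∈ F.atlas)
    (hmem : ∀ q, ∀ x ∈ sphere (g.centre q) g.ℓ, g₁ x ∈ subbox (box q) (ctr q) (ρ / 2))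
    (hm : ∀ q, |m q - (ctr q).2| < ρ / 2) {q : Fin g.n × Fin g.n} {x : ℝ × ℝ} (hx : x ∈ g.sq q) :
    coneMap g box ctr m g₁ x ∈ subbox (box q) (ctr q) (ρ / 2) := by
  have hsrc : ∀ q, ∀ x ∈ sphere (g.centre q) g.ℓ, g₁ x ∈ (box q).source := fun q x hx ↦
    F.subbox_subset_source (hbox q) (hmem q x hx)
  rw [coneMap_eq hsrc hx, ConeSquare.cone_apply]
  have hr := ConeSquare.radial_mem_Icc g.hℓ hx
  refine symm_combo_mem_subbox ?_ ?_ (by linarith [hr.2]) hr.1 (by ring)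
  · rw [mem_ball, Prod.dist_eq, dist_self, Real.dist_eq]
    exact max_lt (by linarith [hm q, abs_nonneg (m q - (ctr q).2)]) (hm q)
  · exact F.apply_mem_ball_of_mem_subbox (hbox q) (hmem q _ (ConeSquare.proj_mem_sphere g.hℓ x))

/-- **The height of the cone filling** on the square `Q`, read in `e_Q`: affine along each
ray, from the apex height `m Q` at the centre to the height of the skeleton map at the
boundary point: `(1 - r) m_Q + r · h_{e_Q} (g₁ (proj x))`. [folklore] -/
theorem height_coneMap (hbox : ∀ q, box q ∈ F.atlas)
    (hsrc : ∀ q, ∀ x ∈ sphere (g.centre q) g.ℓ, g₁ x ∈ (box q).source) {q : Fin g.n × Fin g.n}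
    {x : ℝ × ℝ} (hx : x ∈ g.sq q) :
    height (box q) (coneMap g box ctr m g₁ x) = (1 - ConeSquare.radial (g.centre q) g.ℓ x) * m q +
      ConeSquare.radial (g.centre q) g.ℓ x * height (box q) (g₁ (ConeSquare.proj (g.centre q) g.ℓ x)) := by
  rw [coneMap_eq hsrc hx, height_apply,
    (box q).right_inv (by rw [F.target_eq _ (hbox q)]; exact mem_univ _), ConeSquare.snd_cone]
  rfl

/-- The height of the cone filling along a ray of the square `Q`: at the point of parameter
`t ∈ [0, 1]` of the ray from the centre to the boundary point `y`, it is
`(1 - t) m_Q + t · h_{e_Q} (g₁ y)`. [folklore] -/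
theorem height_coneMap_ray (hbox : ∀ q, box q ∈ F.atlas)
    (hsrc : ∀ q, ∀ x ∈ sphere (g.centre q) g.ℓ, g₁ x ∈ (box q).source) {q : Fin g.n × Fin g.n}
    {y : ℝ × ℝ} (hy : y ∈ sphere (g.centre q) g.ℓ) {t : ℝ} (ht : t ∈ Icc (0 : ℝ) 1) :
    height (box q) (coneMap g box ctr m g₁ (g.centre q + t • (y - g.centre q))) =
      (1 - t) * m q + t * height (box q) (g₁ y) := by
  have hx : g.centre q + t • (y - g.centre q) ∈ g.sq q := by
    rw [Grid.sq, mem_closedBall, dist_eq_norm, add_sub_cancel_left, norm_smul, Real.norm_eq_abs,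
      abs_of_nonneg ht.1, ← dist_eq_norm, mem_sphere.1 hy]
    nlinarith [ht.2, g.hℓ]
  rw [coneMap_eq hsrc hx, height_apply,
    (box q).right_inv (by rw [F.target_eq _ (hbox q)]; exact mem_univ _),
    ConeSquare.snd_cone_ray g.hℓ _ _ hy ht.1]
  rfl

end Cones

/-! ## Cone position: the package -/

section Package

variable {c₀ : ℝ × ℝ} {L : ℝ}

/-- **A cone position of a map `f` of the square `closedBall c₀ L`** with respect to the
foliation `F`: a mesh `n`, flow boxes `e_Q ∈ F.atlas` and a radius `ρ > 0` as in
`exists_boxes` (sub-boxes `G_Q` of radius `ρ` about `e_Q (f c_Q)` inside the sources of the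
boxes of the adjacent squares, `f` of the star of `Q` inside the sub-box of radius `ρ / 4`),
and a **tame skeleton map** `skel` as in `exists_tame_skeleton` (`= f` on the boundary edges,
continuous on the boundary of every square, edges of `Q` inside the sub-box of radius `ρ / 2`,
tame heights along all edges). The squares are then filled by `coneMap` for any choice of
apex heights. [cite: CamachoLinsNeto1985, Ch. VI §3 Prop. 1] -/
structure ConePosition (F : Foliation B M) (f : ℝ × ℝ → M) (c₀ : ℝ × ℝ) {L : ℝ} (hL : 0 < L) where
  /-- the mesh -/
  n : ℕ
  hn : 0 < n
  /-- the flow box of each square -/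
  box : Fin n × Fin n → OpenPartialHomeomorph M (B × ℝ)
  /-- the radius of the sub-boxes -/
  ρ : ℝ
  /-- the tame skeleton map -/
  skel : ℝ × ℝ → M
  hρ : 0 < ρ
  box_mem : ∀ q, box q ∈ F.atlas
  subbox_subset : ∀ q q', (grid c₀ hL hn).Adj q q' →
    subbox (box q) (box q (f ((grid c₀ hL hn).centre q))) ρ ⊆ (box q').source
  apply_mem : ∀ q q', (grid c₀ hL hn).Adj q q' → ∀ x ∈ (grid c₀ hL hn).sq q',
    f x ∈ subbox (box q) (box q (f ((grid c₀ hL hn).centre q))) (ρ / 4)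
  skel_eq : ∀ q k, (grid c₀ hL hn).IsBoundaryEdge q k → ∀ s ∈ Icc 0 (2 * (grid c₀ hL hn).ℓ),
    skel ((grid c₀ hL hn).edge q k s) = f ((grid c₀ hL hn).edge q k s)
  skel_continuousOn : ∀ q, ContinuousOn skel (sphere ((grid c₀ hL hn).centre q) (grid c₀ hL hn).ℓ)
  skel_mem : ∀ q k, ∀ s ∈ Icc 0 (2 * (grid c₀ hL hn).ℓ),
    skel ((grid c₀ hL hn).edge q k s) ∈ subbox (box q) (box q (f ((grid c₀ hL hn).centre q))) (ρ / 2)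
  skel_tame : ∀ q k, TameFunction.IsTameOn
    (fun s ↦ height (box q) (skel ((grid c₀ hL hn).edge q k s))) 0 (2 * (grid c₀ hL hn).ℓ)

variable {F} {f : ℝ × ℝ → M} {hL : 0 < L}

namespace ConePosition

/-- The grid of a cone position. [folklore] -/
noncomputable abbrev gr (P : ConePosition F f c₀ hL) : Grid := grid c₀ hL P.hn

/-- The centre of the sub-box of the square `q`: the box coordinates of `f (c_q)`. [folklore] -/
noncomputable def ctr (P : ConePosition F f c₀ hL) (q : Fin P.n × Fin P.n) : B × ℝ :=
  P.box q (f (P.gr.centre q))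

omit [NormedSpace ℝ B] in
/-- The skeleton map sends the boundary of every square into its sub-box of radius `ρ / 2`.
[folklore] -/
theorem skel_mem_of_mem_sphere (P : ConePosition F f c₀ hL) {q : Fin P.n × Fin P.n} {x : ℝ × ℝ}
    (hx : x ∈ sphere (P.gr.centre q) P.gr.ℓ) : P.skel x ∈ subbox (P.box q) (P.ctr q) (P.ρ / 2) := by
  obtain ⟨k, s, hs, rfl⟩ := P.gr.exists_edge_eq_of_mem_sphere hx
  exact P.skel_mem q k s hs

omit [NormedSpace ℝ B] in
/-- The skeleton map sends the boundary of every square into the source of its box. [folklore] -/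
theorem skel_mem_source (P : ConePosition F f c₀ hL) {q : Fin P.n × Fin P.n} {x : ℝ × ℝ}
    (hx : x ∈ sphere (P.gr.centre q) P.gr.ℓ) : P.skel x ∈ (P.box q).source :=
  F.subbox_subset_source (P.box_mem q) (P.skel_mem_of_mem_sphere hx)

omit [NormedSpace ℝ B] in
/-- **The skeleton map equals `f` on the boundary of the big square.** [folklore] -/
theorem skel_eq_of_mem_sphere (P : ConePosition F f c₀ hL) {x : ℝ × ℝ} (hx : x ∈ sphere c₀ L) :
    P.skel x = f x := by
  have hx' : x ∈ sphere P.gr.bigCentre (P.gr.n * P.gr.ℓ) := by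
    have h := grid_S (c₀ := c₀) hL P.hn
    simp only [Grid.S] at h
    -- same centre and radius as read off from the equality of closed balls
    have hn' : (P.n : ℝ) ≠ 0 := Nat.cast_ne_zero.2 P.hn.ne'
    have h1 : (P.gr.n : ℝ) * P.gr.ℓ = L := by
      show (P.n : ℝ) * (L / P.n) = L
      field_simp
    have h2 : P.gr.bigCentre = c₀ := by
      show ((c₀.1 - L) + (P.n : ℝ) * (L / P.n), (c₀.2 - L) + (P.n : ℝ) * (L / P.n)) = c₀
      ext <;> simp only <;> field_simp <;> ring
    rwa [h2, h1]
  obtain ⟨q, k, s, hb, hs, rfl⟩ := P.gr.exists_isBoundaryEdge_of_mem_sphere hx'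
  exact P.skel_eq q k hb s hs

/-- **The filled map** of a cone position, for a choice of apex heights `m`. [folklore] -/
noncomputable def fill (P : ConePosition F f c₀ hL) (m : Fin P.n × Fin P.n → ℝ) : ℝ × ℝ → M :=
  coneMap P.gr P.box P.ctr m P.skel

/-- Admissible apex heights: within `ρ / 2` of the height of `f` at the centre. [folklore] -/
def AdmissibleApex (P : ConePosition F f c₀ hL) (m : Fin P.n × Fin P.n → ℝ) : Prop :=
  ∀ q, |m q - (P.ctr q).2| < P.ρ / 2

variable (P : ConePosition F f c₀ hL) {m : Fin P.n × Fin P.n → ℝ}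

/-- The filled map on the square `Q` is the cone of `Q`. [folklore] -/
theorem fill_eq {q : Fin P.n × Fin P.n} {x : ℝ × ℝ} (hx : x ∈ P.gr.sq q) :
    P.fill m x = (P.box q).symm (ConeSquare.cone (P.gr.centre q) P.gr.ℓ ((P.ctr q).1, m q)
      (fun y ↦ P.box q (P.skel y)) x) :=
  coneMap_eq (fun _ _ hx ↦ P.skel_mem_source hx) hx

/-- **The filled map equals the skeleton map on the 1-skeleton.** [folklore] -/
theorem fill_of_mem_sphere {q : Fin P.n × Fin P.n} {x : ℝ × ℝ} (hx : x ∈ sphere (P.gr.centre q) P.gr.ℓ) :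
    P.fill m x = P.skel x :=
  coneMap_of_mem_sphere (fun _ _ hx ↦ P.skel_mem_source hx) hx

/-- **The filled map equals `f` on the boundary of the big square** (for every choice of
apex heights). [folklore] -/
theorem fill_eq_of_mem_sphere {x : ℝ × ℝ} (hx : x ∈ sphere c₀ L) : P.fill m x = f x := by
  have hxS : x ∈ P.gr.S := by rw [grid_S]; exact sphere_subset_closedBall hx
  obtain ⟨q, hq⟩ := P.gr.exists_mem_sq hxS
  -- `x` is on a boundary edge, hence on the boundary of its square
  have hx' : x ∈ sphere P.gr.bigCentre (P.gr.n * P.gr.ℓ) := by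
    have h1 : (P.gr.n : ℝ) * P.gr.ℓ = L := by
      show (P.n : ℝ) * (L / P.n) = L
      have hn' : (P.n : ℝ) ≠ 0 := Nat.cast_ne_zero.2 P.hn.ne'
      field_simp
    have h2 : P.gr.bigCentre = c₀ := by
      have hn' : (P.n : ℝ) ≠ 0 := Nat.cast_ne_zero.2 P.hn.ne'
      show ((c₀.1 - L) + (P.n : ℝ) * (L / P.n), (c₀.2 - L) + (P.n : ℝ) * (L / P.n)) = c₀
      ext <;> simp only <;> field_simp <;> ring
    rwa [h2, h1]
  obtain ⟨q', k, s, -, hs, rfl⟩ := P.gr.exists_isBoundaryEdge_of_mem_sphere hx'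
  rw [P.fill_of_mem_sphere (P.gr.edge_mem_sphere q' k hs)]
  exact P.skel_eq_of_mem_sphere hx

/-- **The filled map is continuous on the big square.** [folklore] -/
theorem continuousOn_fill : ContinuousOn (P.fill m) (closedBall c₀ L) := by
  rw [← grid_S hL P.hn]
  exact F.continuousOn_coneMap P.box_mem (fun _ _ hx ↦ P.skel_mem_source hx) P.skel_continuousOn

/-- **The filled map sends each square into its sub-box** (admissible apex heights).
[folklore] -/
theorem fill_mem_subbox (hm : P.AdmissibleApex m) {q : Fin P.n × Fin P.n} {x : ℝ × ℝ}
    (hx : x ∈ P.gr.sq q) : P.fill m x ∈ subbox (P.box q) (P.ctr q) (P.ρ / 2) :=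
  F.coneMap_mem_subbox P.box_mem (fun _ _ hx ↦ P.skel_mem_of_mem_sphere hx) hm hx

/-- The filled map sends each square into the source of its box. [folklore] -/
theorem fill_mem_source (hm : P.AdmissibleApex m) {q : Fin P.n × Fin P.n} {x : ℝ × ℝ}
    (hx : x ∈ P.gr.sq q) : P.fill m x ∈ (P.box q).source :=
  F.subbox_subset_source (P.box_mem q) (P.fill_mem_subbox hm hx)

/-- The filled map sends each square into the sources of the boxes of the adjacent squares.
[folklore] -/
theorem fill_mem_source_of_adj (hm : P.AdmissibleApex m) {q q' : Fin P.n × Fin P.n}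
    (hadj : P.gr.Adj q q') {x : ℝ × ℝ} (hx : x ∈ P.gr.sq q) : P.fill m x ∈ (P.box q').source :=
  P.subbox_subset q q' hadj (subbox_mono _ _ (by linarith [P.hρ]) (P.fill_mem_subbox hm hx))

/-- **Heights of the filled map along rays**: on the ray of `Q` from the centre to the
boundary point `y`, at parameter `t ∈ [0, 1]`, the `e_Q`-height is `(1 - t) m_Q + t ψ_Q(y)`
with `ψ_Q = h_{e_Q} ∘ skel` the (tame) boundary height. [folklore] -/
theorem height_fill_ray {q : Fin P.n × Fin P.n} {y : ℝ × ℝ} (hy : y ∈ sphere (P.gr.centre q) P.gr.ℓ)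
    {t : ℝ} (ht : t ∈ Icc (0 : ℝ) 1) :
    height (P.box q) (P.fill m (P.gr.centre q + t • (y - P.gr.centre q))) =
      (1 - t) * m q + t * height (P.box q) (P.skel y) :=
  F.height_coneMap_ray P.box_mem (fun _ _ hx ↦ P.skel_mem_source hx) hy ht

/-- Heights of the filled map in cone coordinates. [folklore] -/
theorem height_fill {q : Fin P.n × Fin P.n} {x : ℝ × ℝ} (hx : x ∈ P.gr.sq q) :
    height (P.box q) (P.fill m x) = (1 - ConeSquare.radial (P.gr.centre q) P.gr.ℓ x) * m q +
      ConeSquare.radial (P.gr.centre q) P.gr.ℓ x *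
        height (P.box q) (P.skel (ConeSquare.proj (P.gr.centre q) P.gr.ℓ x)) :=
  F.height_coneMap P.box_mem (fun _ _ hx ↦ P.skel_mem_source hx) hx

end ConePosition

/-- **Existence of a cone position** (`C⁰` general position of a square with respect to a
transversely oriented codimension-one foliation; Camacho–Lins Neto, Ch. VI §3 Prop. 1 and
Ch. VII §2, `C⁰` version). Every continuous map `f` of the square `closedBall c₀ L` into `M`
whose heights along the boundary sides are tame in every flow box (for instance a leaf path,
or a curve with monotone heights) admits a cone position: `exists_boxes`, then
`exists_tame_skeleton`. The filled maps `ConePosition.fill` are then continuous on the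
square, equal to `f` on its boundary, and explicit (cones) in the boxes.
[cite: CamachoLinsNeto1985, Ch. VI §3 Prop. 1] -/
theorem IsTransverselyOriented.nonempty_conePosition [ProperSpace B] [T2Space M]
    (ho : F.IsTransverselyOriented) (hL : 0 < L)
    (hf : ContinuousOn f (closedBall c₀ L))
    (hbd : ∀ (n : ℕ) (hn : 0 < n), ∀ e ∈ F.atlas, ∀ q k, (grid c₀ hL hn).IsBoundaryEdge q k →
      (∀ s ∈ Icc 0 (2 * (grid c₀ hL hn).ℓ), f ((grid c₀ hL hn).edge q k s) ∈ e.source) →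
      TameFunction.IsTameOn (fun s ↦ height e (f ((grid c₀ hL hn).edge q k s))) 0 (2 * (grid c₀ hL hn).ℓ)) :
    Nonempty (ConePosition F f c₀ hL) := by
  obtain ⟨n, hn, box, ρ, hρ, hbox, hsrc, hf4⟩ := F.exists_boxes hL hf
  have hf' : ContinuousOn f (grid c₀ hL hn).S := by rwa [grid_S]
  obtain ⟨g₁, h₁, h₂, h₃, h₄⟩ := ho.exists_tame_skeleton (grid c₀ hL hn) hbox hρ hf' hsrc hf4
    fun q k hb ↦ hbd n hn (box q) (hbox q) q k hb fun s hs ↦ F.subbox_subset_source (hbox q)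
      (hf4 q q ((grid c₀ hL hn).adj_refl q) _ ((grid c₀ hL hn).edge_mem_sq q k hs))
  exact ⟨⟨n, hn, box, ρ, g₁, hρ, hbox, hsrc, hf4, h₁, h₂, h₃, h₄⟩⟩

end Package

end Foliation

end Literature.Topology.FourManifolds
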